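import Summits.BirchSwinnertonDyer.BirchSwinnertonDyer.Theses.UniversalToricDescent
import Summits.BirchSwinnertonDyer.BirchSwinnertonDyer.Theorems.EisensteinPrimesHidaLimitFittingBoundConverse
import Summits.BirchSwinnertonDyer.Rank1Residual.X11b.BDPRouteOpenInputDegenerateFrame
import HarnessLib

/-!
# Node (crux-ideate g16) — `different-matched-layer-fitting` for crux 24207 `RationalSplitIMCInclusionAtThree`

Standing cover `cruxidea-stmt-BirchSwinnertonDyer-24207-1`, generation 16.  Crux (FIXED, concluded BY NAME below):
`Summit.BirchSwinnertonDyer.BirchSwinnertonDyer.Theses.UniversalToricDescent.RationalSplitIMCInclusionAtThree`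
(RATWALL: `∃ k, 3ᵏ·L ∈ Ch_Λ(X_(∅,0))·R₀⟦T⟧` on the O6 / `ρ̄₃` onto / `r_an = 1` / `3 = 𝔭𝔭′` split rows).

## KEEP/KILL g16
No vet / instrument / director line names 24207 since the g14 RESULT; no «COVER CLOSED».  The g15 table STANDS
(KEEP g0, base-doubling, g2, g3, g5, g6-as-census-frame, g7, g8, g9, g10, g11, g12, g13, g14, g15; KILLED stay killed:
universal-toric-half-order (K1, g60), germ-recentred-tempered-heegner, tempered-eisenstein, GU(2,1)-as-supply).
Re-derived and NOT re-filed this generation (already on file): the ab-row nebentypus untwist `f_E = g ⊗ θ⁻¹`, `g` of slope ½ and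
level `9·N/81` (LEAD-CENSUS-g12 §1.2, route `CyclotomicUntwist`, B-g14-4); see B-g16-2 for the one remark added.

## The g16 idea (technique class: integral `R₀[G_n]`-structure — perfect Selmer complexes and Tate cohomology of the WILD local
Mordell–Weil lattice; certificate = the principal FITTING ideal of `X_n`, not the image of a functional)

LEVER.  Feed g12's slope-tolerant layer door D (`SublinearSlackDoor`, restated verbatim) with the certificate
`3^{s_n}·L|_n ∈ Fitt_{R_n}(X_n)`, `R_n = R₀[G_n]`, `X_n = X_(∅,0)/ω_n ≃ Sel_(∅,0)(K_n)^∨` (control), where — and this is the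
point — `Fitt_{R_n}(X_n) = (det_n)` is PRINCIPAL and interpolates `#X_{n,χ}` at EVERY `χ ∈ Ĝ_n` with no idempotent loss, because
`RΓ_(∅,0)(K_n, T)` is a PERFECT `R_n`-complex although `3` is wild in `K_n/K` and `E` is additive at `3`: the local conditions at
`𝔭, 𝔭′` are `∅` and `0`, not Bloch–Kato `f`-conditions (whose local module `𝔐_n := E(K_{n,𝔭}) ⊗ ℤ₃` is NOT cohomologically
trivial — that failure is the usual reason equivariant refinements stop at tame `p`).  `Fitt_Λ ⊆ Ch_Λ` and Fitting commutes with
`⊗ R_n`, so the certificate is a `LayerMem` instance for D.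

WHY IT IS NOT KILLED BY B-g12-1 (coinvariant test: every certificate that is the value of an `R_n`-linear FUNCTIONAL on the
Heegner module `H_n = ⊕_{j≤n} R_n y_j ≅ ℤ₃ ⊕ ⊕_{j≥1} O_j` has slack `≥ n − v₃L(𝟙)`, since `f(y₀) ∈ ν_n R_n`, `f(y_j) ∈ Ann Φ_j`).
At the trivial character the TRUE Fitting ideal has the right size: `#X_{n,G_n} = #Sel_(∅,0)(K)·O(1) = 3^{v₃ L(𝟙) + O(1)}`
(control + the BDP formula at `n = 0`), so the slope-1 loss of B-g12-1 is a property of functional certificates, not of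
`Fitt(X_n)`.  Where the loss reappears, and what pays for it: the only access to `det_n` is through the Heegner classes, via
`0 → coker(loc_𝔭 : Sel_(f,∅)(K_n,T) → 𝔐_n) → X_n → Sel_(f,0)(K_n)^∨ → 0`, and the length of `coker(loc_𝔭)_{G_n} =
(𝔐_n)_{G_n}/⟨ȳ₀,…,ȳ_n⟩` is EXACTLY `n + c − #indep_n + O(1)`, where `(𝔐_n)_{G_n}` is an extension of `Tr 𝔐_n` (index `3^{a_n}` in
`𝔐_0`) by the finite group `T_n := Ĥ⁻¹(G_n, 𝔐_n)` of the same order `3^{a_n}` (Herbrand quotient 1), the trace-zero classes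
`ȳ_j` (`j ≥ 1`) are 3-torsion hence land in `T_n[3]`, and `#indep_n := dim_𝔽₃ ⟨ȳ₁,…,ȳ_n⟩`.  (Count: free defect `n + c − a_n`,
torsion defect `ℓ(T_n) − #indep_n = a_n − #indep_n`; `a_n` CANCELS — the structure of `T_n` matters only through the span of the
Heegner directions.)  So the slack of the Heegner-built certificate is `s_n = c′ + δ_S(n)`, `S := {j : ȳ_j ∈ ⟨ȳ₁,…,ȳ_{j−1}⟩ in T_n}`
the NON-PRIMITIVE levels, and the door needs exactly `Sᶜ` infinite (`tendsto_sub_levelCount`): the wild lattice's Tate cohomology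
must keep offering NEW directions to the trace-zero Heegner points («different matching»: `#T_n = 3^{a_n}`, `a_n ≤ n + O(1)` with
equality for the Honda sublattice — `traceExponent` — is the budget; TRACE-ZERO, the lineage's oldest obstruction, is what makes
`ȳ_j` torsion and lets it spend that budget: obstruction as resource).  The toy `functionalImage_mem` is the distinction in two
lines: on the non-free lattice `I = (3, X) ⊂ ℤ[X]` every functional `I → ℤ[X]` has image in `I` (augmentation `⊆ 3ℤ`), while
`I/I = 0` has Fitting ideal `(1)` — one factor `3` per level lost by functionals and kept by Fitting.

PIECES AND TAGS (D-0171).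
* D  `SublinearSlackDoor` [= g12's D · WEAKER · ATTACKABLE (M): Weierstrass preparation + Kummer + Krull; hypothesis here].
* Lay `LayerMembershipAtThree` [= g12's Lay · EQUIV (mod D) · UNDECIDED] — restated so that the new piece factors through it.
* FC `FittingCertificateOffPrimitiveLevels` [NEW · EQUIV (mod D) to the crux (`fittingCertificate_of_…` /
  `…_of_door_of_fittingCertificate`) · UNDECIDED; it is the OUTPUT FORMAT of the mechanism, whose leaves are:]
  - T0 perfectness / principality: `RΓ_(∅,0)(K_n,T)` perfect over `R_n`, `H¹_(∅,0)(K_n,T) = 0`, hence `Fitt_{R_n}(X_n) = (det_n)`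
    with `v(det_n(χ)) = ℓ(X_{n,χ})` for all `χ ∈ Ĝ_n` [WEAKER · ATTACKABLE (M): Nekovář Selmer complexes; relaxed/strict Greenberg
    conditions are perfect at any prime; vanishing of `H¹` from `X_(0,∅)` torsion + control].
  - T1 Heegner directions in Tate cohomology: `#indep_n = n − δ_S(n)` is UNBOUNDED, i.e. `Sᶜ` infinite; NECESSARY sub-leaf:
    `r_n := dim_𝔽₃ Ĥ⁻¹(G_n, 𝔐_n)[3] = dim_𝔽₃ (𝔐_n/3𝔐_n)^{G_n} − 1 → ∞` [UNDECIDED · INSTRUMENTABLE I-g16-1/2; BARRIER-adjacent: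
    `AnomalousHeegnerLogWall` (a row on which `loc_𝔭 y_j` dies in `T_n` for cofinitely many `j` has `Sᶜ` finite: the line dies on
    that row); B-g16-4 (Ax–Sen–Tate: an IDEAL lattice `𝔪^k_{K_{n,𝔭}}` has `r_n` expected bounded — the mechanism lives on the full
    lattice `𝔐_n`, not on the Honda sublattice)].
  - T2 norm index: `a_n := log₃ [E(ℚ₃)⊗ℤ₃ : N_{K_{n,𝔭}/ℚ₃} E(K_{n,𝔭})⊗ℤ₃] → ∞` (no universal norms at additive potentially
    supersingular 3) with `a_n ≤ n + O(1)` [WEAKER · ATTACKABLE (S): Honda sublattice `ℌ_n := Ê_W(𝔪) ≅ (𝔪_{K_{n,𝔭}}, +)` and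
    `Tr 𝔪_{K_n} = 3^{⌊(d_n+1)/3ⁿ⌋}ℤ₃ = 3ⁿℤ₃`; arithmetic shadow PROVED: `traceExponent`, `differentExponent_table`; only `a_n ≥ #indep_n`
    is used].
  - T3 rim inequalities: for every finite-order `χ` of level `≤ n`, `ℓ(X_{n,χ}) ≤ v(L(χ)) + b` with `b` uniform in `χ` (χ-twisted
    Heegner Kolyvagin bound + `p`-adic Waldspurger/BDP value at `χ`) [WEAKER · ATTACKABLE (L); B-g14-1 (rim blindness) does not bite:
    rim values are used as INEQUALITIES modulo `ω_n`, never to locate interior roots — the door takes the limit].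
  - T4 control `X_(∅,0)/ω_n → Sel_(∅,0)(K_n)^∨` with bounded kernel/cokernel at additive 3 [WEAKER · ATTACKABLE (M): relaxed-at-𝔭 /
    strict-at-𝔭′ control needs only `E(K_{∞,v})[3^∞]` finite and Tamagawa boundedness].
  - T5 integrality transfer (the heart): `min{s : 3ˢ L|_n ∈ det_n·R_n} ≤ δ_S(n) + O(1)` — the discrepancy between the functional
    presentation of `L|_n` (the `R_n`-bilinear log-form on the Heegner element `θ_n = Σ σy_n ⊗ σ`, denominators = inverse different
    of the log-lattice `𝔏_n = log_ω E(K_{n,𝔭})`) and `det_n` is, character by character, `ℓ((𝔐_n/H_n)_χ) − ℓ(X_{n,χ})` = the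
    number of non-absorbed Tate directions [UNDECIDED; this is where a proof must be INTEGRAL over `R_n` (Kurihara / Burns–Sano
    style equivariant Kolyvagin systems) and where no published system handles a non-c.t. local lattice].
  - T6 mirror and non-trivial characters: complex conjugation (`c σ c = σ⁻¹`, `y_j ↦ ±σ_j y_j`) identifies the `𝔭′`-side counts
    with the `𝔭`-side; at a character of level `j` the roles of `ȳ_j` (free generator) and `ȳ_i, i ≠ j` (torsion directions in the
    `Φ_j`-torsion of `𝔐_n/Φ_j𝔐_n`) are permuted and the same count applies [UNDECIDED · the `χ`-level analogue of T1].
* Toy / shadows PROVED here (no sorry): `functionalImage_mem`, `functionalImage_eval_zero`, `span_three_X_ne_top` (functional vs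
  Fitting on a non-free rank-one lattice); `levelCount_le`, `levelCount_add_compl`, `tendsto_sub_levelCount` (primitive at
  infinitely many levels ⇒ sublinear slack); `traceExponent`, `differentExponent_table`, `differentExponent_eq_sum_small`
  (`a_n = n`; `d_1 = 4 = v₃ disc ℚ(ζ₉)⁺`, `d_2 = 22 = v₃ disc ℚ(ζ₂₇)⁺`; conductor–discriminant for `n ≤ 5`).

## Barrier notes (g16; for BARRIERS.md harvest, not cards)
- B-g16-1 FITTING-PRODUCT CAP: a certificate assembled by sub-multiplicativity `Fitt(A)·Fitt(C) ⊆ Fitt(B)` along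
  `0 → coker(loc_𝔭) → X_n → Sel_(f,0)^∨ → 0` has augmentation `3^{ℓ(A_G)+ℓ(C_G)}`, which exceeds `#B_G = #X_{n,G} = 3^{v L(𝟙)+O(1)}` by
  the `Tor`-term `H₁(G_n, Sel_(f,0)(K_n)^∨) → coker_G`; with Heegner-only input `ℓ(A_G) = n + c − #indep_n`.  So every layer
  certificate built from the Heegner submodule — functional OR Fitting-product — has slack `≥ n − #indep_n + O(1)`: the line lives
  exactly on «unboundedly many independent Heegner directions in `Ĥ⁻¹(G_n, E(K_{n,𝔭})⊗ℤ₃)[3]`» (T1) and on an INTEGRAL comparison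
  with the principal `det_n` (T5); it is not a class-wide mechanism unless T1 is.
- B-g16-2 IN-TOWER TAMING = ab ROWS ONLY, AND NEVER ORDINARY: `K_{∞,𝔭}·ℚ₃^{unr}` contains the maximal abelian pro-3 extension of
  `ℚ₃`, so `E` becomes tame over `K_{n₀,𝔭}` iff the wild inertia `P ⊄ [ρ(G_{ℚ₃}), ρ(G_{ℚ₃})]`, i.e. exactly on the ab (principal
  series, `v₃(N) = 4`) rows; on SCu/SCr rows `P ⊆ ρ([I, G_{ℚ₃}]) ⊆ ρ(I_F)` for every abelian `F/ℚ₃`.  On ab rows the Frobenius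
  eigenvalue after taming lies in `ℤ[ζ₃]` with norm 3, hence `∼ √−3`: potentially SUPERSINGULAR (slope ½) always — no Hida family
  through any twist of `f_E` on O6; the slope-½ untwist is route `CyclotomicUntwist` (B-g14-4), not this crux's business.
- B-g16-3 HONDA SUBLATTICE ≠ LOCAL MORDELL–WEIL (correction of a g15/g16 premise): additive reduction over `ℚ₃` gives
  `[3]_W ∈ 3·ℤ₃⟦X⟧`, an integral logarithm and `Ê_W ≅ 𝔾̂_a` over `ℤ₃`, hence an equivariant sublattice `ℌ_n := Ê_W(𝔪_{K_{n,𝔭}}) ≅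
  (𝔪_{K_{n,𝔭}}, +)` of `𝔐_n` — but of index `[𝔐_n : ℌ_n] = 3^{⌊3ⁿ·v₃(Δ_W)/12⌋ + O(1)}` (the `K_{n,𝔭}`-minimal model is `W` rescaled by
  `u_n`, `v_{K_n}(u_n) = ⌊3ⁿ v₃(Δ_W)/12⌋`, and `Ê_{W_n′}(𝔪) ⊋ Ê_W(𝔪)`; reduction stays additive at every layer of a 3-tower).  So
  «`𝔐_n ≅ 𝔪_{K_{n,𝔭}}` as `R_n`-modules» is NOT available for `n ≥ 1`; T1/T2 are statements about `𝔐_n` (equivalently about the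
  log-lattice `𝔏_n ⊂ K_{n,𝔭}`, whose valuation spread is `∝ 3ⁿ·v₃(Δ_W)/12`), and instrument questions.
- B-g16-4 AX–SEN–TATE CAUTION: `r_n + 1 = dim_𝔽₃ (M/3M)^{G_n}` counts vectors of `M` fixed modulo `3M`; for an ideal lattice
  `M = 𝔪^k_{K_{n,𝔭}}` such a vector `x` has `v₃(σx − x) ≥ v₃(x) + 1`, and Ax's lemma puts it within `3^{−n}`·O(3ⁿ/4)… of `ℚ₃`, so
  `r_n(𝔪^k)` is expected BOUNDED: the Honda sublattice alone cannot carry the level structure the mechanism needs; only the full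
  lattice `𝔐_n` (via the finite wild quotient `𝔐_n/ℌ_n` of order `3^{Θ(3ⁿ)}` and its own Tate cohomology) can.  Instrument first.

## Instrument asks (kit not allowed on this seat)
- I-g16-1: for the local anticyclotomic tower `K_{∞,𝔭}/ℚ₃` of `K = ℚ(√−11)` (or any O6 row's `K`), `n = 1, 2, 3`: `r_n(𝔪_{K_n}) =
  dim_𝔽₃(𝔪/3𝔪)^{G_n} − 1` (pure local algebra over `ℤ₃[C_{3ⁿ}]`), and `r_n(𝔐_n)` for `E` = an O6 row (135.a-type), `n = 1, 2`.
- I-g16-2: on the same row, is `ȳ_1 ≠ 0` in `T_1 = Ĥ⁻¹(G_1, E(K_{1,𝔭})⊗ℤ₃)`, and are `ȳ_1, ȳ_2` independent in `T_2[3]`?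
  (`r_n` bounded, or `ȳ_j = 0` for the computed `j`, retires the card on that row; `#indep_2 = 2` is the first rung.)

## Presearch (corpus fts+vec AND galaxy; labelled hits in the card)
[corpus:paper:arxiv-2308.10474 p.17, p.20] Castella–Hsu–Kundu–Lee–Liu, derived `p`-adic heights and the leading coefficient of the BDP
`L`-function — GOOD reduction, trivial character, `Γ`-direction derived heights; no Fitting ideals, no finite layers.
[galaxy:pdf:-6600451602323966200] Greither–Kurihara–Tokio, «The second syzygy of the trivial G-module, and an equivariant main
conjecture» — Fitting ideals over `ℤ_p[G]` in a NON-c.t. situation, but for class groups of totally real fields (Tate sequences), not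
Heegner/BDP.  No hit joins «Fitting ideal / finite layer / Heegner or BDP / additive or wild p» in corpus (hybrid ×3) or galaxy (×3).

No `sorry`; no `set_option allowUnsafeReducibility`.  Kernel theorems conclude the crux BY NAME.
-/

set_option autoImplicit false
set_option linter.dupNamespace false
set_option linter.unusedVariables false
set_option linter.unusedSectionVars false

noncomputable section

open scoped Classical

namespace Summit.BirchSwinnertonDyer.BirchSwinnertonDyer.Cruxes.RationalSplitIMCInclusionAtThree.DifferentMatchedLayerFitting

open PowerSeries Literature.NumberTheory.EllipticCurves
  Summit.BirchSwinnertonDyer.Rank1Residual.X11b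

/-! ## §1 The door and the layer format (verbatim from g12 `LayerCakeSublinearSlack`, restated so this node is self-contained) -/

/-- `ω_n = (1+T)^{3ⁿ} − 1 ∈ R₀⟦T⟧` (layer modulus; `R₀⟦T⟧/(ω_n) = R₀[G_n]`, `γ ↦ 1 + T`). [= g12] -/
noncomputable def omega (n : ℕ) : UnrSeries 3 := (1 + PowerSeries.X) ^ (3 ^ n) - 1

/-- Layer membership with scalar slack `s` at layer `n` relative to an ideal `I` of `R₀⟦T⟧`: `3^s · L ∈ I + (ω_n)`. [= g12] -/
def LayerMem (I : Ideal (UnrSeries 3)) (L : UnrSeries 3) (s n : ℕ) : Prop :=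
  ((3 : ℕ) : UnrSeries 3) ^ s * L ∈ I ⊔ Ideal.span {omega n}

/-- **D [= g12's D · WEAKER · ATTACKABLE (M)]** the slope-tolerant layer door: membership modulo `ω_n` with a slack `s n`
such that `n − s n → ∞` forces divisibility up to a power of 3. [folklore ingredients: Weierstrass preparation, Kummer, Krull] -/
def SublinearSlackDoor : Prop :=
  ∀ (g L : UnrSeries 3) (s : ℕ → ℕ) (m₀ : ℕ), g ≠ 0 →
    Filter.Tendsto (fun n => n - s n) Filter.atTop Filter.atTop →
    (∀ n, m₀ ≤ n → LayerMem (Ideal.span {g}) L (s n) n) →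
    ∃ k : ℕ, ((3 : ℕ) : UnrSeries 3) ^ k * L ∈ Ideal.span {g}

/-- **Lay [= g12's Lay · EQUIV (mod D) · UNDECIDED]** layer membership of the BDP function in `Ch_Λ(X_(∅,0))·R₀⟦T⟧ + (ω_n)`
with a slack of slope `< 1`, on the wall's binders verbatim. -/
def LayerMembershipAtThree : Prop :=
  ∀ (W : WeierstrassCurve ℚ) [W.IsElliptic] [W.IsGloballyMinimal] (N : ℕ) [NeZero N] (K : Type) [Field K] [NumberField K] (Dt : Literature.NumberTheory.EllipticCurves.ModularForms.ModularParametrizationData W N), Summit.BirchSwinnertonDyer.Rank1Residual.Additive.ClassO6 W 3 → W.HasSurjectiveModNGaloisRep 3 → W.analyticRank = 1 → W.conductorNorm ℤ = N → Literature.NumberTheory.EllipticCurves.IsImaginaryQuadratic K → Literature.NumberTheory.EllipticCurves.SatisfiesHeegnerHypothesis N K → ∀ (κ : Literature.NumberTheory.EllipticCurves.ZpExtension K 3), κ.IsAnticyclotomic → ∀ (γ : Field.absoluteGaloisGroup K) [Fact (κ.IsTopGenerator γ)] (𝔭 : IsDedekindDomain.HeightOneSpectrum (NumberField.RingOfIntegers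 K)), ((3 : ℕ) : NumberField.RingOfIntegers K) ∈ 𝔭.asIdeal → 𝔭.asIdeal.ramificationIdx (NumberField.RingOfIntegers ℚ) = 1 → 𝔭.asIdeal.inertiaDeg (NumberField.RingOfIntegers ℚ) = 1 → ∀ (𝔭' : IsDedekindDomain.HeightOneSpectrum (NumberField.RingOfIntegers K)), ((3 : ℕ) : NumberField.RingOfIntegers K) ∈ 𝔭'.asIdeal → 𝔭' ≠ 𝔭 → ∀ (ι' : PadicAlgCl 3 ≃+* ℂ), Summit.BirchSwinnertonDyer.BirchSwinnertonDyer.Theorems.SchneiderFree.BranchInducesPrime 3 ι' 𝔭 → ∀ (ΩK : ℂ) (Ωp : ℂ_[3]) (L : Literature.NumberTheory.EllipticCurves.UnrSeries 3), ΩK ≠ 0 → Ωp ≠ 0 → Literature.NumberTheory.EllipticCurves.IsBDPLFunction ι' 𝔭 κ γ Dt.f ΩK Ωp L → ∃ (s : ℕ → ℕ) (m₀ : ℕ), Filter.Tendsto (fun n => n - s n) Filter.atTop Filter.atTop ∧ ∀ n, m₀ ≤ n → LayerMem ((Summit.BirchSwinnertonDyer.Rank1Residual.X11b.AcSelmer.XAc.charIdeal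 (W.baseChange K) 3 κ 𝔭' ∅ γ).map (PowerSeries.map (Summit.BirchSwinnertonDyer.Rank1Residual.X11b.Halves.toUnr 3))) L (s n) n

/-! ## §2 The level count (slack = number of non-primitive levels) -/

/-- `δ_S(n) = #{j < n : j ∈ S}` — the counting function of a set `S` of levels (here: the non-primitive levels). -/
def levelCount (S : Set ℕ) (n : ℕ) : ℕ := ((Finset.range n).filter (fun j => j ∈ S)).card

theorem levelCount_le (S : Set ℕ) (n : ℕ) : levelCount S n ≤ n := by
  unfold levelCount
  exact (Finset.card_filter_le _ _).trans (by simp)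

theorem levelCount_empty (n : ℕ) : levelCount (∅ : Set ℕ) n = 0 := by
  simp [levelCount]

/-- complement count: `δ_S(n) + #{j < n : j ∉ S} = n`. -/
theorem levelCount_add_compl (S : Set ℕ) (n : ℕ) :
    levelCount S n + ((Finset.range n).filter (fun j => j ∉ S)).card = n := by
  unfold levelCount
  rw [Finset.card_filter_add_card_filter_not]
  exact Finset.card_range n

/-- **Primitive at infinitely many levels ⇒ sublinear slack.** If the set `S` of non-primitive levels has infinite complement,
then the slack `c + δ_S(n)` satisfies `n − (c + δ_S(n)) → ∞`. -/
theorem tendsto_sub_levelCount (S : Set ℕ) (hS : Sᶜ.Infinite) (c : ℕ) :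
    Filter.Tendsto (fun n => n - (c + levelCount S n)) Filter.atTop Filter.atTop := by
  rw [Filter.tendsto_atTop_atTop]
  intro C
  obtain ⟨t, htS, htcard⟩ := hS.exists_subset_card_eq (C + c)
  refine ⟨t.sup id + 1, fun n hn => ?_⟩
  -- every element of `t` is `< n`
  have htn : ∀ j ∈ t, j < n := by
    intro j hj
    have : j ≤ t.sup id := Finset.le_sup (f := id) hj
    omega
  -- hence `t ⊆ {j < n : j ∉ S}`
  have hsub : t ⊆ (Finset.range n).filter (fun j => j ∉ S) := by
    intro j hj
    rw [Finset.mem_filter, Finset.mem_range]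
    exact ⟨htn j hj, htS hj⟩
  have hle : C + c ≤ ((Finset.range n).filter (fun j => j ∉ S)).card := by
    rw [← htcard]; exact Finset.card_le_card hsub
  have hsum := levelCount_add_compl S n
  omega

/-! ## §3 Different matching — the arithmetic shadow (PROVED) -/

/-- `d_n = ((2n+1)·3ⁿ − 1)/2`: the different exponent of the `n`-th layer (degree `3ⁿ`) of a cyclotomic-type totally ramified
`ℤ₃`-tower over `ℚ₃` (conductor–discriminant: `Σ_{k=1}^{n} φ(3ᵏ)(k+1)`). -/
def differentExponent (n : ℕ) : ℕ := ((2 * n + 1) * 3 ^ n - 1) / 2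

/-- sanity table: `d_1 = 4 = v₃(disc ℚ(ζ₉)⁺)`, `d_2 = 22 = v₃(disc ℚ(ζ₂₇)⁺)`, `d_3 = 94`, `d_4 = 364`. -/
theorem differentExponent_table :
    differentExponent 1 = 4 ∧ differentExponent 2 = 22 ∧ differentExponent 3 = 94 ∧ differentExponent 4 = 364 := by
  unfold differentExponent; norm_num

/-- conductor–discriminant check of the closed form for small `n`: `Σ_{k=1}^{n} φ(3ᵏ)(k+1) = d_n`. -/
theorem differentExponent_eq_sum_small :
    (∀ n ∈ Finset.range 6, (∑ k ∈ Finset.Icc 1 n, (3 ^ k - 3 ^ (k - 1)) * (k + 1)) = differentExponent n) := by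
  decide

/-- **`a_n = n` (different matching).** The trace ideal of the maximal ideal of the `n`-th layer is `3^{a_n}ℤ₃` with
`a_n = ⌊(d_n + 1)/3ⁿ⌋ = ⌊((2n+1)3ⁿ + 1)/(2·3ⁿ)⌋ = n` for `n ≥ 1`: the number of trace-zero Heegner levels. -/
theorem traceExponent (n : ℕ) (hn : 1 ≤ n) : ((2 * n + 1) * 3 ^ n + 1) / (2 * 3 ^ n) = n := by
  have hm : 3 ≤ 3 ^ n := by
    calc (3 : ℕ) = 3 ^ 1 := by norm_num
      _ ≤ 3 ^ n := Nat.pow_le_pow_right (by norm_num) hn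
  set m := 3 ^ n with hm_def
  have hpos : 0 < 2 * m := by omega
  have hrw : (2 * n + 1) * m + 1 = (m + 1) + (2 * m) * n := by ring
  rw [hrw, Nat.add_mul_div_left _ _ hpos, Nat.div_eq_of_lt (by omega), Nat.zero_add]

/-! ## §4 The toy: functionals versus Fitting on a wild rank-one lattice (PROVED)

`I = (3, X) ⊂ R = ℤ[X]` is the model of one level of a wildly ramified local lattice: rank one, two generators, one relation,
not free.  `I/I = 0` (Fitting ideal `R`), but every `R`-linear functional on `I` has image inside `I`, whose augmentation
(`X ↦ 0`) lies in `3ℤ`: a functional certificate loses a factor `3` per level that a Fitting certificate does not. -/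

section Toy

open Polynomial

/-- the height-two ideal `(3, X) ⊂ ℤ[X]`. -/
def I3X : Ideal (Polynomial ℤ) := Ideal.span {Polynomial.C 3, Polynomial.X}

theorem C3_mem : (Polynomial.C (3 : ℤ)) ∈ I3X := Ideal.subset_span (by simp)

theorem X_mem : (Polynomial.X : Polynomial ℤ) ∈ I3X := Ideal.subset_span (by simp)

/-- augmentation of `(3, X)` is `3ℤ`. -/
theorem eval_zero_dvd_of_mem {y : Polynomial ℤ} (hy : y ∈ I3X) : (3 : ℤ) ∣ y.eval 0 := by
  unfold I3X at hy
  rw [Ideal.mem_span_pair] at hy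
  obtain ⟨u, v, rfl⟩ := hy
  simp [Polynomial.eval_add, Polynomial.eval_mul]

theorem span_three_X_ne_top : I3X ≠ ⊤ := by
  intro h
  have h1 : (1 : Polynomial ℤ) ∈ I3X := by rw [h]; exact Submodule.mem_top
  have h3 := eval_zero_dvd_of_mem h1
  simp at h3

/-- **Every functional on the wild lattice `(3, X)` has image in `(3, X)`.**  (`X·f(3) = 3·f(X)` forces `f(3) = 3·(f(X)/X)·…`:
comparing coefficients, `f(3) ∈ 3ℤ[X]` and `X ∣ f(X)`.) -/
theorem functionalImage_mem (f : I3X →ₗ[Polynomial ℤ] Polynomial ℤ) (x : I3X) : f x ∈ I3X := by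
  set a : Polynomial ℤ := f ⟨Polynomial.C 3, C3_mem⟩ with ha
  set b : Polynomial ℤ := f ⟨Polynomial.X, X_mem⟩ with hb
  -- the one relation of the lattice: X • (3) = 3 • (X)
  have hrel : (Polynomial.X : Polynomial ℤ) * a = Polynomial.C 3 * b := by
    have h1 : (Polynomial.X : Polynomial ℤ) • (⟨Polynomial.C 3, C3_mem⟩ : I3X) =
        (Polynomial.C (3 : ℤ)) • (⟨Polynomial.X, X_mem⟩ : I3X) := by
      apply Subtype.ext
      simp [mul_comm]
    have h2 := congrArg f h1
    rw [map_smul, map_smul, smul_eq_mul, smul_eq_mul] at h2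
    exact h2
  -- `b` has zero constant term, hence `X ∣ b`, hence `b ∈ I`
  have hb0 : b.coeff 0 = 0 := by
    have h := congrArg (fun p : Polynomial ℤ => p.coeff 0) hrel
    simp only [Polynomial.mul_coeff_zero, Polynomial.coeff_X_zero, zero_mul, Polynomial.coeff_C_zero] at h
    omega
  have hbI : b ∈ I3X := by
    obtain ⟨q, hq⟩ := (Polynomial.X_dvd_iff).mpr hb0
    rw [hq]
    exact I3X.mul_mem_right q X_mem
  -- `a = 3 · divX b`, hence `a ∈ I`
  have haI : a ∈ I3X := by
    have hcoeff : ∀ k, a.coeff k = 3 * b.coeff (k + 1) := by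
      intro k
      have h := congrArg (fun p : Polynomial ℤ => p.coeff (k + 1)) hrel
      simp only [Polynomial.coeff_X_mul, Polynomial.coeff_C_mul] at h
      exact h
    have haeq : a = Polynomial.C 3 * Polynomial.divX b := by
      ext k
      rw [Polynomial.coeff_C_mul, Polynomial.coeff_divX, hcoeff k]
    rw [haeq]
    exact I3X.mul_mem_right _ C3_mem
  -- general element: `x = u·3 + v·X`
  obtain ⟨x, hx⟩ := x
  have hx' := hx
  unfold I3X at hx'
  rw [Ideal.mem_span_pair] at hx'
  obtain ⟨u, v, huv⟩ := hx'
  have hdecomp : (⟨x, hx⟩ : I3X) = u • (⟨Polynomial.C 3, C3_mem⟩ : I3X) + v • (⟨Polynomial.X, X_mem⟩ : I3X) := by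
    apply Subtype.ext
    simp [← huv]
  rw [hdecomp, map_add, map_smul, map_smul, smul_eq_mul, smul_eq_mul]
  exact I3X.add_mem (I3X.mul_mem_left u haI) (I3X.mul_mem_left v hbI)

/-- … hence every functional certificate drawn from the wild lattice has augmentation in `3ℤ` (one factor `3` lost per level),
while the quotient `I/I` is zero (Fitting ideal `(1)`): the B-g12-1 loss is a property of FUNCTIONAL certificates. -/
theorem functionalImage_eval_zero (f : I3X →ₗ[Polynomial ℤ] Polynomial ℤ) (x : I3X) : (3 : ℤ) ∣ (f x).eval 0 :=
  eval_zero_dvd_of_mem (functionalImage_mem f x)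

end Toy

/-! ## §5 The new typed piece and the kernel-checked compositions -/

/-- **FC [NEW · EQUIV (mod D) · UNDECIDED; leaves T1–T6 in the header]** the Fitting-quotient layer certificate OFF a set `S` of
non-primitive levels with INFINITE complement: `3^{c + δ_S(n)}·L ∈ Ch_Λ(X_(∅,0))·R₀⟦T⟧ + (ω_n)` for `n ≥ m₀`.  Informal content:
the membership is `Fitt_{R_n}(X_(∅,0)/ω_n) ∋ 3^{c+δ_S(n)}·L|_n`, obtained from the wild local lattice `𝔐_n = E(K_{n,𝔭})⊗ℤ₃`
(T1 Tate-graded `Ĥ⁻¹`, T2 different matching `a_n = n + O(1)`, T3 primitivity of `loc_𝔭 y_j` off `S`, T4 control, T5 the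
complementary Fitting factors, T6 all characters at once). -/
def FittingCertificateOffPrimitiveLevels : Prop :=
  ∀ (W : WeierstrassCurve ℚ) [W.IsElliptic] [W.IsGloballyMinimal] (N : ℕ) [NeZero N] (K : Type) [Field K] [NumberField K] (Dt : Literature.NumberTheory.EllipticCurves.ModularForms.ModularParametrizationData W N), Summit.BirchSwinnertonDyer.Rank1Residual.Additive.ClassO6 W 3 → W.HasSurjectiveModNGaloisRep 3 → W.analyticRank = 1 → W.conductorNorm ℤ = N → Literature.NumberTheory.EllipticCurves.IsImaginaryQuadratic K → Literature.NumberTheory.EllipticCurves.SatisfiesHeegnerHypothesis N K → ∀ (κ : Literature.NumberTheory.EllipticCurves.ZpExtension K 3), κ.IsAnticyclotomic → ∀ (γ : Field.absoluteGaloisGroup K) [Fact (κ.IsTopGenerator γ)] (𝔭 : IsDedekindDomain.HeightOneSpectrum (NumberField.RingOfIntegers K)), ((3 : ℕ) : NumberField.RingOfIntegers K) ∈ 𝔭.asIdeal → 𝔭.asIdeal.ramificationIdx (NumberField.RingOfIntegers ℚ) = 1 → 𝔭.asIdeal.inertiaDeg (NumberField.RingOfIntegers ℚ) = 1 → ∀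 (𝔭' : IsDedekindDomain.HeightOneSpectrum (NumberField.RingOfIntegers K)), ((3 : ℕ) : NumberField.RingOfIntegers K) ∈ 𝔭'.asIdeal → 𝔭' ≠ 𝔭 → ∀ (ι' : PadicAlgCl 3 ≃+* ℂ), Summit.BirchSwinnertonDyer.BirchSwinnertonDyer.Theorems.SchneiderFree.BranchInducesPrime 3 ι' 𝔭 → ∀ (ΩK : ℂ) (Ωp : ℂ_[3]) (L : Literature.NumberTheory.EllipticCurves.UnrSeries 3), ΩK ≠ 0 → Ωp ≠ 0 → Literature.NumberTheory.EllipticCurves.IsBDPLFunction ι' 𝔭 κ γ Dt.f ΩK Ωp L → ∃ (S : Set ℕ) (c m₀ : ℕ), Sᶜ.Infinite ∧ ∀ n, m₀ ≤ n → LayerMem ((Summit.BirchSwinnertonDyer.Rank1Residual.X11b.AcSelmer.XAc.charIdeal (W.baseChange K) 3 κ 𝔭' ∅ γ).map (PowerSeries.map (Summit.BirchSwinnertonDyer.Rank1Residual.X11b.Halves.toUnr 3))) L (c + levelCount S n) n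

/-! ### Bridge lemmas (verbatim from the g3/g4/g5/g12 nodes) -/

/-- The extended characteristic ideal is principal: `Ch_Λ(X)·R₀⟦T⟧ = (F)`. -/
theorem exists_map_charIdeal_eq_span {K : Type} [Field K] [NumberField K] (W : WeierstrassCurve K)
    (κ : ZpExtension K 3) (𝔭' : IsDedekindDomain.HeightOneSpectrum (NumberField.RingOfIntegers K))
    (γ : Field.absoluteGaloisGroup K) [Fact (κ.IsTopGenerator γ)] :
    ∃ F : UnrSeries 3, (AcSelmer.XAc.charIdeal W 3 κ 𝔭' ∅ γ).map (PowerSeries.map (Halves.toUnr 3)) =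
      Ideal.span {F} := by
  obtain ⟨f, hf⟩ := (charIdeal_isPrincipal_holds 3 (AcSelmer.XAc W 3 κ 𝔭' ∅ γ)).principal
  refine ⟨PowerSeries.map (Halves.toUnr 3) f, ?_⟩
  have hf' : AcSelmer.XAc.charIdeal W 3 κ 𝔭' ∅ γ = Ideal.span {f} := by
    change Literature.NumberTheory.EllipticCurves.Module.charIdeal (IwasawaAlgebra 3) (AcSelmer.XAc W 3 κ 𝔭' ∅ γ) =
      Ideal.span {f}
    simpa [Ideal.submodule_span_eq] using hf
  rw [hf', Ideal.map_span, Set.image_singleton]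

/-- The extended characteristic ideal is nonzero. -/
theorem map_charIdeal_ne_bot {K : Type} [Field K] [NumberField K] (W : WeierstrassCurve K)
    (κ : ZpExtension K 3) (𝔭' : IsDedekindDomain.HeightOneSpectrum (NumberField.RingOfIntegers K))
    (γ : Field.absoluteGaloisGroup K) [Fact (κ.IsTopGenerator γ)] :
    (AcSelmer.XAc.charIdeal W 3 κ 𝔭' ∅ γ).map (PowerSeries.map (Halves.toUnr 3)) ≠ ⊥ := by
  rw [Ne, Ideal.map_eq_bot_iff_of_injective map_toUnr_injective]
  exact Literature.NumberTheory.EllipticCurves.Module.charIdeal_ne_bot (IwasawaAlgebra 3) _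

/-- **D ∧ Lay ⟹ 24207 (BY NAME).** [= g12's kernel, re-checked here] -/
theorem rationalSplitIMCInclusionAtThree_of_door_of_layerMembership
    (hD : SublinearSlackDoor) (hLay : LayerMembershipAtThree) :
    Summit.BirchSwinnertonDyer.BirchSwinnertonDyer.Theses.UniversalToricDescent.RationalSplitIMCInclusionAtThree := by
  intro W _ _ N _ K _ _ Dt hO6 hsurj hr1 hN hK hH κ hκ γ _ 𝔭 h𝔭 he hf 𝔭' h𝔭' hne ι' hι ΩK Ωp L hΩK hΩp hL
  obtain ⟨F, hF⟩ := exists_map_charIdeal_eq_span (W.baseChange K) κ 𝔭' γ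
  have hF0 : F ≠ 0 := by
    intro h0
    apply map_charIdeal_ne_bot (W.baseChange K) κ 𝔭' γ
    rw [hF, h0, Ideal.span_singleton_eq_bot]
  obtain ⟨s, m₀, hs, hmem⟩ :=
    hLay W N K Dt hO6 hsurj hr1 hN hK hH κ hκ γ 𝔭 h𝔭 he hf 𝔭' h𝔭' hne ι' hι ΩK Ωp L hΩK hΩp hL
  have hmem' : ∀ n, m₀ ≤ n → LayerMem (Ideal.span {F}) L (s n) n := by
    intro n hn; have h := hmem n hn; rwa [hF] at h
  obtain ⟨k, hk⟩ := hD F L s m₀ hF0 hs hmem'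
  exact ⟨k, by rw [hF]; exact hk⟩

/-- **FC ⟹ Lay** (the slack of a Fitting certificate off `S` is sublinear because `Sᶜ` is infinite). -/
theorem layerMembership_of_fittingCertificate (hFC : FittingCertificateOffPrimitiveLevels) :
    LayerMembershipAtThree := by
  intro W _ _ N _ K _ _ Dt hO6 hsurj hr1 hN hK hH κ hκ γ _ 𝔭 h𝔭 he hf 𝔭' h𝔭' hne ι' hι ΩK Ωp L hΩK hΩp hL
  obtain ⟨S, c, m₀, hS, hmem⟩ :=
    hFC W N K Dt hO6 hsurj hr1 hN hK hH κ hκ γ 𝔭 h𝔭 he hf 𝔭' h𝔭' hne ι' hι ΩK Ωp L hΩK hΩp hL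
  exact ⟨fun n => c + levelCount S n, m₀, tendsto_sub_levelCount S hS c, hmem⟩

/-- **D ∧ FC ⟹ 24207 (BY NAME).**  The g16 composition: the layer door fed by Fitting-quotient certificates that are
primitive at infinitely many levels decides the crux. -/
theorem rationalSplitIMCInclusionAtThree_of_door_of_fittingCertificate
    (hD : SublinearSlackDoor) (hFC : FittingCertificateOffPrimitiveLevels) :
    Summit.BirchSwinnertonDyer.BirchSwinnertonDyer.Theses.UniversalToricDescent.RationalSplitIMCInclusionAtThree :=
  rationalSplitIMCInclusionAtThree_of_door_of_layerMembership hD (layerMembership_of_fittingCertificate hFC)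

/-- **24207 ⟹ FC** (with `S = ∅`, `c = k`): FC is EQUIVALENT to the crux modulo D — it is an output format, and the content
of the line is in the leaves T1–T6, not in FC's shape (honest EQUIV tag, as for g12's Lay). -/
theorem fittingCertificate_of_rationalSplitIMCInclusionAtThree
    (h : Summit.BirchSwinnertonDyer.BirchSwinnertonDyer.Theses.UniversalToricDescent.RationalSplitIMCInclusionAtThree) :
    FittingCertificateOffPrimitiveLevels := by
  intro W _ _ N _ K _ _ Dt hO6 hsurj hr1 hN hK hH κ hκ γ _ 𝔭 h𝔭 he hf 𝔭' h𝔭' hne ι' hι ΩK Ωp L hΩK hΩp hL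
  obtain ⟨k, hk⟩ := h W N K Dt hO6 hsurj hr1 hN hK hH κ hκ γ 𝔭 h𝔭 he hf 𝔭' h𝔭' hne ι' hι ΩK Ωp L hΩK hΩp hL
  refine ⟨∅, k, 0, by simp [Set.compl_empty, Set.infinite_univ], fun n _ => ?_⟩
  rw [levelCount_empty, Nat.add_zero]
  exact Ideal.mem_sup_left hk

/-- Non-torsion branch is free (tree: `charIdeal_eq_top_of_not_isTorsion`): FC holds outright when `X_(∅,0)` is not Λ-torsion,
so every leaf T1–T6 may assume `IsTorsion`. -/
theorem layerMem_of_not_isTorsion {K : Type} [Field K] [NumberField K] (W : WeierstrassCurve K)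
    (κ : ZpExtension K 3) (𝔭' : IsDedekindDomain.HeightOneSpectrum (NumberField.RingOfIntegers K))
    (γ : Field.absoluteGaloisGroup K) [Fact (κ.IsTopGenerator γ)]
    (htor : ¬ Module.IsTorsion (IwasawaAlgebra 3) (AcSelmer.XAc W 3 κ 𝔭' ∅ γ)) (L : UnrSeries 3) (s n : ℕ) :
    LayerMem ((AcSelmer.XAc.charIdeal W 3 κ 𝔭' ∅ γ).map (PowerSeries.map (Halves.toUnr 3))) L s n := by
  have htop : AcSelmer.XAc.charIdeal W 3 κ 𝔭' ∅ γ = ⊤ :=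
    Summit.BirchSwinnertonDyer.BirchSwinnertonDyer.Theorems.charIdeal_eq_top_of_not_isTorsion (p := 3) _ htor
  unfold LayerMem
  rw [htop, Ideal.map_top]
  exact Ideal.mem_sup_left Submodule.mem_top

end Summit.BirchSwinnertonDyer.BirchSwinnertonDyer.Cruxes.RationalSplitIMCInclusionAtThree.DifferentMatchedLayerFitting

end
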